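import Summits.BirchSwinnertonDyer.Rank1Residual.X5.TwoAdicTargetsMultEndAlpha
import Literature.NumberTheory.EllipticCurves.Greenberg1999.EulerCharacteristicNonsplitMultiplicativeAnyPrime
import HarnessLib

/-!
# O1 (X5 at `p = 2`, non-CM): the algebraic control slot at a NON-SPLIT MULTIPLICATIVE `2` is
# PUBLISHED (`δ = 0`) — `TwoAdicEulerCharRankZeroNonsplitMult W 0` from Greenberg's printed display

HONEST FRAMING (cell `b2b-bsdres`, run/shared/lean/b2b/bsd-rank1-residual/, verbatim in every
file): the goal of the cell is to DELETE the COMBINATION-SHAPED residual classes of the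
Birch–Swinnerton-Dyer formula for ALL analytic-rank `≤ 1` elliptic curves over `ℚ` — "full BSD
formula for every rank `≤ 1` curve in class `C`" assembled STRICTLY from published theorems — so
that the rank-`≤ 1` remainder becomes exactly the CONSTRUCTION-SHAPED classes, which are TYPED
(missing-input `Prop`s), NOT attempted. This is not "finishing BSD". Research routes; no claim
beyond stated classes; census output = EVIDENCE, never a Literature fact; nothing here is booked;
no mark of RESIDUAL-MAP §I moves.

Unit `b2b-bsdres-cc-typer-4` (lane CLASS-CLOSURE, class O1), gen 4 — the multiplicative twin of
`X5/TwoAdicTargetsPub.lean`. RELABEL of the E1-mult target `O1.TwoAdicEulerCharRankZeroNonsplitMult W δ`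
(`X5/TwoAdicTargetsMultEnd.lean`: Greenberg's "analogue of theorem 4.1" at a non-split multiplicative
`2`, `l_v = 2`, with a control-term slot `δ`): the literature seat's parity-free named fact
`Greenberg1999.thm41Analogue_charValue_rankZero_numberField_anyPrime` (p259148, cell registry A235;
Greenberg, LNM 1716 (1999) §4 pp. 112–113, "If p = 2, then `|ker(r_v)| = 2c_v^{(p)}` […] one can take
`l_v = 2` (for any prime p)", held copy `book:coates1999-arithmetic-theory-elliptic-curves` chunks
p0112 L3–L7 / p0113 L1) and its PROVED `F = ℚ`, `p = 2` projection `….nonsplit_two` make the `δ = 0`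
instance a CONSEQUENCE OF A PUBLISHED STATEMENT:
`twoAdicEulerCharRankZeroNonsplitMult_zero_of_greenberg` (the lit seat's "one-liner on ACCEPT" ask,
HOME/INBOX 09:34Z 2026-08-21). The two α-ns END-STATE consumers of `X5/TwoAdicTargetsMultEndAlpha.lean`
are then restated with `hEC` fed by the named fact (`…_of_greenberg`): on the Prop. 5.14 locus at a
non-split multiplicative `2`, rank `0`, the per-pair inputs of `BSDp W 2` are PRINT {Prop. 5.14 at `2`
(`prop514_isTorsion_mu_eq_zero_two`), the analogue of Thm. 4.1 at `2` (THIS fact), modularity, GZK} +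
K11a (`KatoDivisibilityAtTwoNonsplitMultRat`, NOT in print; price AUDIT S–M per lens-3 G6.1) + the
Néron-integrality certificate `hint` + `MissingLowerBoundAt W 2`. For the census: the algebraic `δ` is
NOT a slack source on non-split-multiplicative-`2` rank-`0` rows either. Nothing is booked; the named
fact is the lit seat's (nothing minted here; 0 defs).
-/

noncomputable section

open scoped Classical MatrixGroups ModularForm

open CongruenceSubgroup WeierstrassCurve Literature.NumberTheory.EllipticCurves
  Literature.NumberTheory.EllipticCurves.ModularForms
  Literature.NumberTheory.EllipticCurves.Greenberg1999
  Literature.NumberTheory.EllipticCurves.Rank1Residual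
  Literature.NumberTheory.EllipticCurves.Rank1Residual.Typed

set_option autoImplicit false

namespace Summit.BirchSwinnertonDyer.Rank1Residual.X5.O1

variable (W : WeierstrassCurve ℚ) [W.IsElliptic] [W.IsGloballyMinimal]

omit [W.IsGloballyMinimal] in
/-- **`TwoAdicEulerCharRankZeroNonsplitMult W 0` from Greenberg's printed display (parity-free named
fact).** Given the vendored fact `Greenberg1999.thm41Analogue_charValue_rankZero_numberField_anyPrime`
(Greenberg, LNM 1716, §4 pp. 112–113: "the analogue of theorem 4.1", `l_v = 2` at a non-split
multiplicative `v` "for any prime p"), the O1 control target at a non-split multiplicative `2` holds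
with `δ = 0`: `f_E(0) · #E(ℚ)(2)² = u · 2^{ord₂ ∏ c_ℓ + 1} · #Sel_{2^∞}(E/ℚ)`. The target's binder
`IsCyclotomicVariable 2 γ` is unused (the display holds for every topological generator), and its
`zpow` exponent at `δ = 0` is the fact's natural-number exponent.
[cite: GreenbergLNM1716, §4 pp. 112–113 (held copy `book:coates1999-arithmetic-theory-elliptic-curves` p0112 L3–L7, p0113 L1)] -/
theorem twoAdicEulerCharRankZeroNonsplitMult_zero_of_greenberg
    (h : thm41Analogue_charValue_rankZero_numberField_anyPrime) :
    TwoAdicEulerCharRankZeroNonsplitMult W 0 := by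
  intro hmult hns κ γ hκ hγ _hγ' D _ hX fE hfE hfin
  obtain ⟨u, hu⟩ := h.nonsplit_two W hmult hns κ γ hκ hγ D hX fE hfE hfin
  refine ⟨u, ?_⟩
  rw [add_zero, zpow_natCast]
  exact hu

omit [W.IsGloballyMinimal] in
/-- The slack slot is inert: any `δ`-instance with `δ = 0` is the printed display. Bookkeeping twin
of `twoAdicEulerCharRankZero_of_greenberg_of_eq_zero`. [folklore] -/
theorem twoAdicEulerCharRankZeroNonsplitMult_of_greenberg_of_eq_zero
    (h : thm41Analogue_charValue_rankZero_numberField_anyPrime) {δ : ℤ} (hδ : δ = 0) :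
    TwoAdicEulerCharRankZeroNonsplitMult W δ := by
  subst hδ
  exact twoAdicEulerCharRankZeroNonsplitMult_zero_of_greenberg W h

/-- **α-ns upper half with the control slot PUBLISHED.** `missingUpperBoundAt_two_nonsplit_of_prop514`
with `hEC` fed by Greenberg's named fact: on a curve with non-split multiplicative reduction at `2`,
analytic rank `0`, and a ramified-XOR-odd rational `2`-torsion point (Prop. 5.14 locus), the inputs of
`MissingUpperBoundAt W 2` are PRINT {`prop514_isTorsion_mu_eq_zero_two`,
`thm41Analogue_charValue_rankZero_numberField_anyPrime`, modularity, GZK} + K11a (`hK`, NOT in print)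
+ the Néron-integrality certificate (`hint`). [cite: GreenbergLNM1716, Prop. 5.14 (p. 121) and §4 pp. 112–113]
[cite: Miller2011LMS, Def. 1.1] -/
theorem missingUpperBoundAt_two_nonsplit_of_prop514_of_greenberg
    (h514 : prop514_isTorsion_mu_eq_zero_two)
    (h41 : thm41Analogue_charValue_rankZero_numberField_anyPrime)
    (hmod : nonempty_modularParametrizationData)
    (hGZK : rank_eq_analyticRank_of_analyticRank_le_one)
    (hK : ∀ [NeZero (W.conductorNorm ℤ)] (f : CuspForm (Gamma0 (W.conductorNorm ℤ)) 2)
      (L : PowerSeries ℚ_[2]), KatoDivisibilityAtTwoNonsplitMultRat W f L)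
    (hint : ∀ [NeZero (W.conductorNorm ℤ)] (f : CuspForm (Gamma0 (W.conductorNorm ℤ)) 2),
      IsNewformOf W f → ∀ ϖ : ℚ, (ϖ : ℝ) * W.realPeriodRat = plusPeriod f →
      ∀ L : PowerSeries ℚ_[2], IsMultPAdicLFunctionOf f 2 (-1) L →
        ∃ L₀ : IwasawaAlgebra 2, iwasawaToPowerSeries 2 L₀ = PowerSeries.C (ϖ : ℚ_[2]) * L)
    (hr : W.analyticRank = 0) (hmult : Mult W 2) (hns : ¬ W.HasSplitMultiplicativeReductionAtPrime 2)
    {x y : ℚ} (hP : W.toAffine.Equation x y) (h2 : 2 * y + W.a₁ * x + W.a₃ = 0)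
    (hΦ : (TwoTorsionRamifiedAtTwo x ∧ ¬ TwoTorsionOdd W x) ∨
      (TwoTorsionOdd W x ∧ ¬ TwoTorsionRamifiedAtTwo x)) : MissingUpperBoundAt W 2 :=
  missingUpperBoundAt_two_nonsplit_of_prop514 W h514
    (twoAdicEulerCharRankZeroNonsplitMult_zero_of_greenberg W h41) hmod hGZK hK hint hr hmult hns
    hP h2 hΦ

/-- **α-ns END-STATE per pair with the control slot PUBLISHED: `BSD(E,2)` on the Prop. 5.14 locus at
a non-split multiplicative `2` from the lower half.** `bsdp_two_nonsplit_of_prop514_of_lowerBound` with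
`hEC` fed by Greenberg's named fact. What is NOT a published theorem among the inputs: K11a (`hK`,
price AUDIT S–M: Kato §17.13 `⊗ ℚ` under `T″ = ℤ₂(φ)`), and the two certificates `hint`, `hlow`. One
member per isogeny class suffices (`bsdp_two_iff_of_isIsogenous`). Nothing is booked.
[cite: GreenbergLNM1716, Prop. 5.14 (p. 121) and §4 pp. 112–113] [cite: Miller2011LMS, Def. 1.1 and §1] -/
theorem bsdp_two_nonsplit_of_prop514_of_lowerBound_of_greenberg
    (h514 : prop514_isTorsion_mu_eq_zero_two)
    (h41 : thm41Analogue_charValue_rankZero_numberField_anyPrime)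
    (hmod : nonempty_modularParametrizationData)
    (hGZK : rank_eq_analyticRank_of_analyticRank_le_one)
    (hK : ∀ [NeZero (W.conductorNorm ℤ)] (f : CuspForm (Gamma0 (W.conductorNorm ℤ)) 2)
      (L : PowerSeries ℚ_[2]), KatoDivisibilityAtTwoNonsplitMultRat W f L)
    (hint : ∀ [NeZero (W.conductorNorm ℤ)] (f : CuspForm (Gamma0 (W.conductorNorm ℤ)) 2),
      IsNewformOf W f → ∀ ϖ : ℚ, (ϖ : ℝ) * W.realPeriodRat = plusPeriod f →
      ∀ L : PowerSeries ℚ_[2], IsMultPAdicLFunctionOf f 2 (-1) L →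
        ∃ L₀ : IwasawaAlgebra 2, iwasawaToPowerSeries 2 L₀ = PowerSeries.C (ϖ : ℚ_[2]) * L)
    (hr : W.analyticRank = 0) (hmult : Mult W 2) (hns : ¬ W.HasSplitMultiplicativeReductionAtPrime 2)
    {x y : ℚ} (hP : W.toAffine.Equation x y) (h2 : 2 * y + W.a₁ * x + W.a₃ = 0)
    (hΦ : (TwoTorsionRamifiedAtTwo x ∧ ¬ TwoTorsionOdd W x) ∨
      (TwoTorsionOdd W x ∧ ¬ TwoTorsionRamifiedAtTwo x))
    (hlow : MissingLowerBoundAt W 2) : BSDp W 2 :=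
  bsdp_two_nonsplit_of_prop514_of_lowerBound W h514
    (twoAdicEulerCharRankZeroNonsplitMult_zero_of_greenberg W h41) hmod hGZK hK hint hr hmult hns
    hP h2 hΦ hlow

/-- **The general non-split consumer with the control slot PUBLISHED.**
`missingUpperBoundAt_two_nonsplit_of_mu_eq_zero` with `hEC` fed by Greenberg's named fact: rank `0`,
non-split multiplicative `2`, K11a (`hK`) + `μ₂(X) = 0` for the cyclotomic data (`hμ`, e.g. a tower-gap
certificate) + `hint` ⇒ `MissingUpperBoundAt W 2`, modulo modularity and GZK by name.
[cite: GreenbergLNM1716, §4 pp. 112–113] [cite: Miller2011LMS, Def. 1.1] -/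
theorem missingUpperBoundAt_two_nonsplit_of_mu_eq_zero_of_greenberg
    (h41 : thm41Analogue_charValue_rankZero_numberField_anyPrime)
    (hmod : nonempty_modularParametrizationData)
    (hGZK : rank_eq_analyticRank_of_analyticRank_le_one)
    (hK : ∀ [NeZero (W.conductorNorm ℤ)] (f : CuspForm (Gamma0 (W.conductorNorm ℤ)) 2)
      (L : PowerSeries ℚ_[2]), KatoDivisibilityAtTwoNonsplitMultRat W f L)
    (hμ : ∀ (κ : ZpExtension ℚ 2) (γ : Field.absoluteGaloisGroup ℚ), κ.IsCyclotomic →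
      κ.IsTopGenerator γ → IsCyclotomicVariable 2 γ → ∀ D : W.SelmerDualData κ γ, D.mu = 0)
    (hint : ∀ [NeZero (W.conductorNorm ℤ)] (f : CuspForm (Gamma0 (W.conductorNorm ℤ)) 2),
      IsNewformOf W f → ∀ ϖ : ℚ, (ϖ : ℝ) * W.realPeriodRat = plusPeriod f →
      ∀ L : PowerSeries ℚ_[2], IsMultPAdicLFunctionOf f 2 (-1) L →
        ∃ L₀ : IwasawaAlgebra 2, iwasawaToPowerSeries 2 L₀ = PowerSeries.C (ϖ : ℚ_[2]) * L)
    (hr : W.analyticRank = 0) (hmult : Mult W 2)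
    (hns : ¬ W.HasSplitMultiplicativeReductionAtPrime 2) : MissingUpperBoundAt W 2 :=
  missingUpperBoundAt_two_nonsplit_of_mu_eq_zero W
    (twoAdicEulerCharRankZeroNonsplitMult_zero_of_greenberg W h41) hmod hGZK hK hμ hint hr hmult hns

end Summit.BirchSwinnertonDyer.Rank1Residual.X5.O1

end
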